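import Summits.HodgeConjecture.HodgeConjecture.Theorems.MarkmanPartnerTransportPicardThreeK3SquaresZeta9Type
import Summits.HodgeConjecture.HodgeConjecture.Theorems.MarkmanPartnerTransportPicardThreeK3SquaresSqrt2Type
import Summits.HodgeConjecture.HodgeConjecture.Theorems.MarkmanPartnerTransportPartnerTransport
import HarnessLib

/-!
# Route MarkmanPartnerTransport · target `K3Sq2TypeHodge` on the partnered branch (`ρ(X) = 11`):
# HC⁴(X) for every `K3^{[2]}`-type fourfold whose K3 partner is of the ζ₉ or the √2 real-multiplication
# type of van Geemen–Schütt (Picard number 10)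

Cell hodge-nonav; prover seat hodge-nonav-19652-p1 (gen 12); `--supports stmt-HodgeConjecture-19652`,
helper. Composition of `RMTypeOrbit.exists_zeta9Type_hodgeConjectureFor_square` /
`RMTypeOrbit.exists_sqrt2Type_hodgeConjectureFor_square` (`…PicardThreeK3SquaresZeta9Type` /
`…Sqrt2Type`: HC⁴(S ⊗ S) for every marked projective K3 surface `S` whose RM generator is conjugate by a
rational isometry to the ζ₉ model `θ`, resp. the √2 model, of the van Geemen–Schütt families, mod
{Buskin, the respective ∃-form open-set fact}) with support #2 `PartnerTransport` in its PROVED explicit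
form (`PartnerLattice.partnerTransport_explicit`, gen 6: Beauville's marked Hilbert square, blow-up +
surjective descent, Witt extension, Markman's algebraic lift; mod {Beauville ×2, Markman 2024, Voisin
cup}). For the members (`ρ(S) = 10`) the partners have `ρ(X) = 11 ≥ 4`: the PARTNERED branch of the
route's assembly (`PartnerExistence` → `PicardThreeK3Squares` → `PartnerTransport`), here closed by name
for two rational real-multiplication types of the partner. A separate (leaf) file because
`…PartnerTransport` imports the route file. CONDITIONAL on the six displayed named facts ONLY; credits
nothing; neither the crux nor the target nor HC is proved here. No definition, no sorry.

References: van Geemen–Schütt, Forum Math. Sigma 13 (2025) e2, Thm. 1.1 (9), Thm. 1.2 (2), §4.8, §5.6,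
Prop. 6.2, §6.4, Rem. 6.5; Artebani–Comparin–Valdés, Comm. Algebra 48 (2020), Ex. 3.5; E. Markman,
Compos. Math. 160 (2024) Thm. 1.1, 1.4; A. Beauville, J. Differential Geom. 18 (1983) §6; N. Buskin,
J. reine angew. Math. 755 (2019) Thm. 1.1.
-/

set_option linter.dupNamespace false

noncomputable section

namespace Summit.HodgeConjecture.HodgeConjecture.Theorems.MarkmanPartnerTransport.RMTypeOrbit

open CategoryTheory MonoidalCategory Polynomial
open Literature.AlgebraicGeometry Literature.AlgebraicGeometry.Motives Literature.AlgebraicGeometry.HodgeTheory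
open Literature.AlgebraicGeometry.Surfaces Literature.LinearAlgebra.QuadraticForm
open Literature.AlgebraicGeometry.Hyperkaehler Literature.AlgebraicGeometry.HilbertScheme
open Literature.AlgebraicTopology.SingularHomology Literature.Geometry.Kaehler
open Summit.HodgeConjecture.HodgeConjecture.Theorems.NikulinTwinTransport
open Summit.HodgeConjecture.HodgeConjecture.Theorems.MarkmanPartnerTransport.IsogenyInvariance
open Summit.HodgeConjecture.HodgeConjecture.Theorems.MarkmanPartnerTransport.RMTypeDescent

/-- `MarkedK3[S, η, p, x]`: VERBATIM the `let MarkedK3 := …` binder of the route declaration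
`PicardThreeK3Squares` (as in `…RMTypeDescent`). Local notation only. -/
local notation3 (prettyPrint := false) "MarkedK3[" S ", " η ", " p ", " x "]" =>
  (p ≠ 0 ∧ (IsIntegralClass p ∧
    (∀ q : complexBetti S (2 * 2), IsIntegralClass q → ∃ n : ℤ, q = n • p) ∧
    (∀ c : complexBetti S (2 * 1), IsIntegralClass c ↔ ∃ v : K3Index → ℤ, η c = fun i => (v i : ℂ)) ∧
    (∀ a b : complexBetti S (2 * 1),
      cupProduct (rfl : 2 * 1 + 2 * 1 = 2 * 2) a b = k3Form (η a) (η b) • p) ∧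
    IsOfHodgeType 2 S (2 * 1) 2 0 (LinearEquiv.symm η x) ∧
    (∀ τ : complexBetti S (2 * 1), IsOfHodgeType 2 S (2 * 1) 2 0 τ →
      ∃ t : ℂ, τ = t • LinearEquiv.symm η x)) ∧
    (k3Form x x = 0 ∧ 0 < (k3Form (star x) x).re ∧
      ∃ u : K3Index → ℤ, k3Form (fun i => (u i : ℂ)) x = 0 ∧ 0 < ∑ i, ∑ j, u i * k3Gram i j * u j))

/-- `Zeta9Model[g, y₀, θ]`: VERBATIM the datum conjuncts of the named fact
`VanGeemenSchuett2025_zeta9_cycleOnOpenPeriodSet` (as in `…Zeta9Type`). Local notation only. -/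
local notation3 (prettyPrint := false) "Zeta9Model[" g ", " y₀ ", " θ "]" =>
  ((∀ a b : K3Index → ℂ, k3Form (g a) (g b) = k3Form a b) ∧
    (∀ v : K3Index → ℤ, ∃ w : K3Index → ℤ,
      g (fun i => ((v i : ℤ) : ℂ)) = fun i => ((w i : ℤ) : ℂ)) ∧
    g ^ 9 = 1 ∧
    Module.finrank ℂ (LinearMap.ker (g ^ 3 - 1)) = 10 ∧
    k3Form y₀ y₀ = 0 ∧ 0 < (k3Form (star y₀) y₀).re ∧
    g y₀ = Complex.exp (2 * Real.pi * Complex.I / 9) • y₀ ∧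
    (∀ y : K3Index → ℂ, thetaC θ y =
      (1 / 3 : ℂ) • ((2 : ℂ) • g y + (2 : ℂ) • (g ^ 8) y - (g ^ 2) y - (g ^ 4) y - (g ^ 5) y
        - (g ^ 7) y)))

/-- `Sqrt2Model[θ]`: VERBATIM the datum conjuncts of the named fact
`VanGeemenSchuett2025_sqrt2_cycleOnOpenPeriodSet` (as in `…Sqrt2Type`). Local notation only. -/
local notation3 (prettyPrint := false) "Sqrt2Model[" θ "]" =>
  ((∀ a b : K3Index → ℂ, k3Form (thetaC θ a) b = k3Form a (thetaC θ b)) ∧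
    Module.finrank ℂ (LinearMap.ker (thetaC θ)) = 10 ∧
    thetaC θ ^ 3 = (2 : ℂ) • thetaC θ)

/-- `MarkedK3Sq[X, φ, P, z]`: VERBATIM the `let MarkedK3Sq := …` binder of the route declarations of
MarkmanPartnerTransport (clauses (m1)–(m6)), as in `…PartnerTransport`. Local notation only. -/
local notation3 (prettyPrint := false) "MarkedK3Sq[" X ", " φ ", " P ", " z "]" =>
  (((IsIntegralClass P ∧ ∀ Q : complexBetti X (2 * 4), IsIntegralClass Q → ∃ n : ℤ, Q = n • P) ∧
    (∀ c : complexBetti X 2, IsIntegralClass c ↔ ∃ v : K3HilbertIndex → ℤ, φ c = fun i => (v i : ℂ)) ∧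
    (∀ a : complexBetti X 2, cupPowTwo a 4 = ((3 : ℂ) * (k3HilbertForm 2 (φ a) (φ a)) ^ 2) • P) ∧
    (IsOfHodgeType 4 X 2 2 0 (LinearEquiv.symm φ z) ∧
      ∀ τ : complexBetti X 2, IsOfHodgeType 4 X 2 2 0 τ → ∃ t : ℂ, τ = t • LinearEquiv.symm φ z) ∧
    (∀ c : complexBetti X 2, IsOfHodgeType 4 X 2 1 1 c ↔
      (k3HilbertForm 2 (φ c) z = 0 ∧ k3HilbertForm 2 (φ c) (star z) = 0)) ∧
    (k3HilbertForm 2 z z = 0 ∧ 0 < (k3HilbertForm 2 (star z) z).re)))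

/-- `PartnerHC[θ]`: **HC⁴ of every marked smooth projective `K3^{[2]}`-type fourfold with a K3 partner
of rational real-multiplication type `θ`** — for every marked `(X, φ, P, z)` (clauses (m1)–(m6)), every
marked projective K3 surface `(S, η, p, x)` with an endomorphism `t` of `H²(S(ℂ); ℂ)` (rational,
type-preserving, killing `N¹`, image `⊥ N¹`, `P(t) = 0` on `T` for a separable `P` with `P(0) ≠ 0`,
generating `End_Hdg T(S)`) conjugate by a rational isometry `σ` of `Λ_ℚ` to `θ_ℂ`, and every
transcendental Hodge isometry `g : H²(S) → H²(X)` (clauses (g1), (g2), (g5) of the route's partner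
datum): `HodgeConjectureFor 4 X`. Local notation only. -/
local notation3 (prettyPrint := false) "PartnerHC[" θ "]" =>
  (∀ (X : SchemeOver ℂ) (_hX : IsSmoothProjective 4 X) (_hK : IsOfK3HilbertSquareType X)
    (φ : complexBetti X 2 ≃ₗ[ℂ] (K3HilbertIndex → ℂ)) (PX : complexBetti X (2 * 4))
    (z : K3HilbertIndex → ℂ) (_hMX : MarkedK3Sq[X, φ, PX, z])
    (S : SchemeOver ℂ) (_hS : IsK3Surface S) (P : ℚ[X]) (_hPsep : P.Separable) (_hP0 : P.eval 0 ≠ 0)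
    (η : complexBetti S (2 * 1) ≃ₗ[ℂ] (K3Index → ℂ)) (p : complexBetti S (2 * 2)) (x : K3Index → ℂ)
    (_hM : MarkedK3[S, η, p, x])
    (t : complexBetti S (2 * 1) →ₗ[ℂ] complexBetti S (2 * 1))
    (_ht_rat : ∀ y, IsRationalClass y → IsRationalClass (t y))
    (_ht_typ : ∀ (i j : ℕ) (y : complexBetti S (2 * 1)),
      IsOfHodgeType 2 S (2 * 1) i j y → IsOfHodgeType 2 S (2 * 1) i j (t y))
    (_ht_N : ∀ d ∈ algebraicClasses S 1, t d = 0)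
    (_ht_perp : ∀ (y : complexBetti S (2 * 1)), ∀ d ∈ algebraicClasses S 1,
      cupProduct (rfl : 2 * 1 + 2 * 1 = 2 * 2) (t y) d = 0)
    (_hP : IsAnnihilatedOnTranscendentalBy S t P) (_hgen : TranscendentalEndomorphismsGeneratedBy S t)
    (σ : Module.End ℂ (K3Index → ℂ)) (_hσ : ∀ a b, k3Form (σ a) (σ b) = k3Form a b)
    (_hσrat : ∀ v : K3Index → ℤ, ∃ w : K3Index → ℚ, σ (fun i => (v i : ℂ)) = fun i => (w i : ℂ))
    (_hconj : ∀ c : complexBetti S (2 * 1), σ (η (t c)) = thetaC θ (σ (η c)))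
    (gX : complexBetti S (2 * 1) →ₗ[ℂ] complexBetti X 2)
    (_hg1 : ∀ a, IsRationalClass a → IsRationalClass (gX a))
    (_hg2 : ∀ (i j : ℕ) a, IsOfHodgeType 2 S (2 * 1) i j a → IsOfHodgeType 4 X 2 i j (gX a))
    (_hg5 : ∀ a b, (∀ d ∈ algebraicClasses S 1, cupProduct (rfl : 2 * 1 + 2 * 1 = 2 * 2) a d = 0) →
      (∀ d ∈ algebraicClasses S 1, cupProduct (rfl : 2 * 1 + 2 * 1 = 2 * 2) b d = 0) →
      k3HilbertForm 2 (φ (gX a)) (φ (gX b)) = k3Form (η a) (η b)),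
    HodgeConjectureFor 4 X)

/-- **The partnered branch for the ζ₉ real-multiplication type: HC⁴ of every marked smooth projective
`K3^{[2]}`-type fourfold whose K3 partner is of the ζ₉ type (`ρ(S) = 10`, `ρ(X) = 11`).** There is a
ζ₉ datum `(g, y₀, θ)` (as supplied by `VanGeemenSchuett2025_zeta9_cycleOnOpenPeriodSet`: integral
isometry `g` of the K3 lattice, `g⁹ = 1`, cube-fixed part of rank `10`, period `y₀` with
`g y₀ = e^{2πi/9} y₀`, model endomorphism `θ_ℂ = ⅓(2g + 2g⁸ - g² - g⁴ - g⁵ - g⁷)`) such that every marked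
smooth projective `K3^{[2]}`-type fourfold `(X, φ, P, z)` with a transcendental Hodge isometry
`g_X : H²(S) → H²(X)` (clauses (g1), (g2), (g5)) from a marked projective K3 surface `(S, η, p, x)` whose
RM generator is conjugate by a rational isometry to `θ_ℂ` satisfies `HodgeConjectureFor 4 X`:
`HC⁴(S × S)` by `exists_zeta9Type_hodgeConjectureFor_square`, then support #2 in its proved explicit
form `PartnerLattice.partnerTransport_explicit`. CONDITIONAL on {`Buskin2019_hodgeIsometry_algebraic`,
`VanGeemenSchuett2025_zeta9_cycleOnOpenPeriodSet`, `Beauville1983_hilbertSquare_markedIncidence`,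
`Beauville1983_hilbertSquare_blowupDiagonal_surjection`,
`Markman2024_rationalHodgeIsometry_lift_algebraic_marked`, `Voisin2003_cupProduct_algebraicClasses`};
credits nothing; neither the crux nor the target nor HC is proved here.
[cite: GeemenSchutt2023, Thm. 1.1 (9), §4.8, §5.6] [cite: ArtebaniComparinValdes2020Order9, Example 3.5]
[cite: Markman2024, §1.1 Thm. 1.1 and Thm. 1.4] [cite: Beauville1983, §6 (e)–(f), Prop. 6]
[cite: Buskin2019, Thm. 1.1] -/
theorem exists_zeta9Type_hodgeConjectureFor_partner
    (hB : Buskin2019_hodgeIsometry_algebraic) (hV : VanGeemenSchuett2025_zeta9_cycleOnOpenPeriodSet)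
    (hBI : Beauville1983_hilbertSquare_markedIncidence)
    (hBea : Beauville1983_hilbertSquare_blowupDiagonal_surjection)
    (hMk : Markman2024_rationalHodgeIsometry_lift_algebraic_marked)
    (hcup : Voisin2003_cupProduct_algebraicClasses) :
    ∃ (g : Module.End ℂ (K3Index → ℂ)) (y₀ : K3Index → ℂ) (θ : Matrix K3Index K3Index ℚ),
      Zeta9Model[g, y₀, θ] ∧ PartnerHC[θ] := by
  obtain ⟨g, y₀, θ, hZ, hsq⟩ := exists_zeta9Type_hodgeConjectureFor_square hB hV
  refine ⟨g, y₀, θ, hZ, ?_⟩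
  intro X hX hK φ PX z hMX S hS P hPsep hP0 η p x hM t ht_rat ht_typ ht_N ht_perp hP hgen σ hσ hσrat hconj
    gX hg1 hg2 hg5
  obtain ⟨hp0, hmk, hxx, hxpos, hu⟩ := hM
  exact PartnerLattice.partnerTransport_explicit hBI hBea hMk hcup hX hK hMX hS hmk hxx hxpos hu hg1 hg2 hg5
    (hsq S hS P hPsep hP0 η p x ⟨hp0, hmk, hxx, hxpos, hu⟩ t ht_rat ht_typ ht_N ht_perp hP hgen σ hσ hσrat
      hconj)

/-- **The partnered branch for the van Geemen–Schütt √2 real-multiplication type: HC⁴ of every marked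
smooth projective `K3^{[2]}`-type fourfold whose K3 partner is of that type (`ρ(S) = 10`,
`ρ(X) = 11`).** There is a √2 datum `θ` (as supplied by `VanGeemenSchuett2025_sqrt2_cycleOnOpenPeriodSet`:
rational, `k3Form`-self-adjoint, kernel of rank `10`, `θ_ℂ³ = 2θ_ℂ`) such that every marked smooth
projective `K3^{[2]}`-type fourfold `(X, φ, P, z)` with a transcendental Hodge isometry
`g_X : H²(S) → H²(X)` (clauses (g1), (g2), (g5)) from a marked projective K3 surface `(S, η, p, x)`
whose RM generator is conjugate by a rational isometry to `θ_ℂ` satisfies `HodgeConjectureFor 4 X`: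
`HC⁴(S × S)` by `exists_sqrt2Type_hodgeConjectureFor_square`, then
`PartnerLattice.partnerTransport_explicit`. CONDITIONAL on {`Buskin2019_hodgeIsometry_algebraic`,
`VanGeemenSchuett2025_sqrt2_cycleOnOpenPeriodSet`, `Beauville1983_hilbertSquare_markedIncidence`,
`Beauville1983_hilbertSquare_blowupDiagonal_surjection`,
`Markman2024_rationalHodgeIsometry_lift_algebraic_marked`, `Voisin2003_cupProduct_algebraicClasses`};
credits nothing; neither the crux nor the target nor HC is proved here.
[cite: GeemenSchutt2023, Thm. 1.2 (2), Prop. 6.2, §6.4, Rem. 6.5]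
[cite: Markman2024, §1.1 Thm. 1.1 and Thm. 1.4] [cite: Beauville1983, §6 (e)–(f), Prop. 6]
[cite: Buskin2019, Thm. 1.1] -/
theorem exists_sqrt2Type_hodgeConjectureFor_partner
    (hB : Buskin2019_hodgeIsometry_algebraic) (hV : VanGeemenSchuett2025_sqrt2_cycleOnOpenPeriodSet)
    (hBI : Beauville1983_hilbertSquare_markedIncidence)
    (hBea : Beauville1983_hilbertSquare_blowupDiagonal_surjection)
    (hMk : Markman2024_rationalHodgeIsometry_lift_algebraic_marked)
    (hcup : Voisin2003_cupProduct_algebraicClasses) :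
    ∃ θ : Matrix K3Index K3Index ℚ, Sqrt2Model[θ] ∧ PartnerHC[θ] := by
  obtain ⟨θ, hZ, hsq⟩ := exists_sqrt2Type_hodgeConjectureFor_square hB hV
  refine ⟨θ, hZ, ?_⟩
  intro X hX hK φ PX z hMX S hS P hPsep hP0 η p x hM t ht_rat ht_typ ht_N ht_perp hP hgen σ hσ hσrat hconj
    gX hg1 hg2 hg5
  obtain ⟨hp0, hmk, hxx, hxpos, hu⟩ := hM
  exact PartnerLattice.partnerTransport_explicit hBI hBea hMk hcup hX hK hMX hS hmk hxx hxpos hu hg1 hg2 hg5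
    (hsq S hS P hPsep hP0 η p x ⟨hp0, hmk, hxx, hxpos, hu⟩ t ht_rat ht_typ ht_N ht_perp hP hgen σ hσ hσrat
      hconj)

end Summit.HodgeConjecture.HodgeConjecture.Theorems.MarkmanPartnerTransport.RMTypeOrbit

end
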